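import Literature.Analysis.FluidPDE.PassiveScalarDiagForcedExistenceGlobal
import Summits.AnomalousDissipation.AnomalousDissipation.Theorems.ScalarZerothLawKinematicDefs
import HarnessLib

/-!
# The scalar zeroth law over a prescribed carrier — NON-VACUITY: global solutions exist

Theorems file of the kinematic rung `ScalarZerothLawKinematic` (cell `ad-ideate`; objects in
`ScalarZerothLawKinematicDefs`). The statements `ScalarZerothLawQuant` / `ScalarZerothLawLongTime`
quantify over ALL global weak solutions `θ` of the forced problem
`∂ₜθ + b·∇θ = κ(½∂₀∂₀ + ∂₁∂₁)θ + S`, `θ(0) = θ₀`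
(`Torus.IsWeakScalarTransportDiagForced ![2⁻¹, 1] κ b (fun _ => S) θ₀ θ`); this file records that the
class is NONEMPTY for every stirring carrier (`IsStirringCarrier α L b`: space–time measurable,
bounded, weakly divergence free at every time), every `κ > 0`, every steady `L²` (in particular every
smooth) source and every `L²` datum — by the global forced existence theorem
`Torus.exists_isWeakScalarTransportDiagForced_l2Continuous_of_steady` of
`Literature/Analysis/FluidPDE/PassiveScalarDiagForcedExistenceGlobal` (mild solutions of the
inhomogeneous problem glued along horizons, Pazy 1983 Ch. 4 Cor. 2.5) — and that the solution may be
taken `L²`-continuous on `[0,∞)` with `θ 0 = θ₀`. Supports stmt-AnomalousDissipation-0448.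
-/

noncomputable section

-- `Summit.<Summit>.<Problem>` is the tree's mandated summit-side namespace (CONVENTIONS §2); for this
-- single-conjunct summit the two coincide, so the duplicate is deliberate.
set_option linter.dupNamespace false

namespace Summit.AnomalousDissipation.AnomalousDissipation.Theorems.ScalarZerothLawKinematic

open MeasureTheory Set Filter
open scoped NNReal ENNReal
open Literature.Analysis Literature.Analysis.FluidPDE Literature.Analysis.FunctionSpaces

/-- The Hess-Childs–Rowan diffusion coefficients `(½, 1)` are positive. [folklore] -/
theorem diagCoeff_pos : ∀ i : Fin 2, 0 < (![2⁻¹, 1] : Fin 2 → ℝ) i := by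
  intro i
  fin_cases i <;> simp

/-- **Non-vacuity of the scalar zeroth-law statements: global solutions exist over every stirring
carrier.** For a stirring carrier `b` (`IsStirringCarrier α L b`), every `κ > 0`, every steady source
`S ∈ L²(T²)` and every datum `θ₀ ∈ L²(T²)` there is a GLOBAL weak solution `θ` of
`∂ₜθ + b·∇θ = κ(½∂₀∂₀ + ∂₁∂₁)θ + S` with datum `θ₀`
(`Torus.IsWeakScalarTransportDiagForced ![2⁻¹, 1] κ b (fun _ => S) θ₀ θ`) which is the `L²`-continuous
representative on `[0,∞)` with `θ 0 = θ₀` (the tree's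
`Torus.exists_isWeakScalarTransportDiagForced_l2Continuous_of_steady`). [cite: Pazy1983, Ch. 4 §4.2, Cor. 2.5 (inhomogeneous problem), p. 107] -/
theorem exists_solution_of_isStirringCarrier {α : ℝ≥0} {L : ℝ}
    {b : ℝ → UnitAddTorus (Fin 2) → EuclideanSpace ℝ (Fin 2)} (hb : IsStirringCarrier α L b)
    {κ : ℝ} (hκ : 0 < κ) {S : UnitAddTorus (Fin 2) → ℝ} (hS : MemLp S 2 volume)
    {θ₀ : UnitAddTorus (Fin 2) → ℝ} (hθ₀ : MemLp θ₀ 2 volume) :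
    ∃ θ : ℝ → UnitAddTorus (Fin 2) → ℝ,
      Torus.IsWeakScalarTransportDiagForced ![2⁻¹, 1] κ b (fun _ => S) θ₀ θ ∧
      Torus.IsL2ContinuousOn (Ici 0) θ ∧ θ 0 = θ₀ := by
  obtain ⟨hm, ⟨A, hA, -⟩, hdiv, -⟩ := hb
  exact Torus.exists_isWeakScalarTransportDiagForced_l2Continuous_of_steady hκ diagCoeff_pos hθ₀ hm
    (fun t x => hA t x) hdiv hS

/-- **Non-vacuity, smooth steady sources and mean-zero `L²` data** (the exact quantifier pattern of
`ScalarZerothLawQuant` / `ScalarZerothLawLongTime`): for every stirring carrier, `κ > 0`, smooth `S`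
and `θ₀ ∈ L²` there is a global weak solution in the class over which those statements quantify.
[cite: Pazy1983, Ch. 4 §4.2, Cor. 2.5 (inhomogeneous problem), p. 107] -/
theorem exists_solution_of_isStirringCarrier_of_isSmooth {α : ℝ≥0} {L : ℝ}
    {b : ℝ → UnitAddTorus (Fin 2) → EuclideanSpace ℝ (Fin 2)} (hb : IsStirringCarrier α L b)
    {κ : ℝ} (hκ : 0 < κ) {S : UnitAddTorus (Fin 2) → ℝ} (hS : FunctionSpaces.Torus.IsSmooth S)
    {θ₀ : UnitAddTorus (Fin 2) → ℝ} (hθ₀ : MemLp θ₀ 2 volume) :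
    ∃ θ : ℝ → UnitAddTorus (Fin 2) → ℝ,
      Torus.IsWeakScalarTransportDiagForced ![2⁻¹, 1] κ b (fun _ => S) θ₀ θ ∧
      Torus.IsL2ContinuousOn (Ici 0) θ ∧ θ 0 = θ₀ :=
  exists_solution_of_isStirringCarrier hb hκ (hS.memLp 2) hθ₀

end Summit.AnomalousDissipation.AnomalousDissipation.Theorems.ScalarZerothLawKinematic

end
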